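import Literature.NumberTheory.Automorphic.LanglandsTunnellLSeriesProofs
import Literature.NumberTheory.EllipticCurves.CuspFormLFunctionProofs
import HarnessLib

/-!
# Deligne–Serre 1974, (1.7.2) on `re s > 1` in weight one: discharge of
`IsNewform1.hasProd_cuspFormLSeries_weight_one`

D-0014 keeps `Literature/` sorry-free by stating cited results as named facts `def X : Prop`.
This sibling file of `Literature.NumberTheory.Automorphic.LanglandsTunnellLSeriesProofs` **proves**
the named fact
`Literature.NumberTheory.EllipticCurves.ModularForms.IsNewform1.hasProd_cuspFormLSeries_weight_one`
stated there — Deligne–Serre, *Formes modulaires de poids 1*, Ann. Sci. ÉNS (4) 7 (1974), §1.7,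
(1.7.2), p. 509 ("`Φ_f(s) = Σ a_n n^{-s}` admet le développement eulérien
`Φ_f(s) = ∏_{p ∣ N} (1 - a_p p^{-s})⁻¹ ∏_{p ∤ N} (1 - a_p p^{-s} + ε(p) p^{k-1-2s})⁻¹`"), in
weight `k = 1` and on the half-plane `re s > 1` of loc. cit. §9, Thm. 9.1 / Cor. 9.2, p. 527:
for a newform `f = Σ aₙ qⁿ ∈ S_1(Γ₁(N))` with nebentypus `ε` and `re s > 1`,
`L(f, s) = Σ aₙ n^{-s} = ∏_p (1 - a_p p^{-s} + ε(p) (p^{-s})²)⁻¹`, the product over the primes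
converging (`HasProd` over `Nat.Primes`; one formula for both kinds of factors since `ε(p) = 0`
for `p ∣ N`) — as

* `theorem IsNewform1.hasProd_cuspFormLSeries_weight_one_holds :
    IsNewform1.hasProd_cuspFormLSeries_weight_one`;

users holding `(h : IsNewform1.hasProd_cuspFormLSeries_weight_one)` (e.g.
`Literature.NumberTheory.Automorphic.artinLFunction_eq_cuspFormLSeries_of_deligneSerre`) are fed
this theorem.  The statement is discharged exactly as vendored (region `re s > 1`).

## The proof

"Il en résulte" (loc. cit. p. 509): the Euler product is formal from `a_1 = 1` and the Hecke
relations once `Σ aₙ n^{-s}` converges absolutely (Diamond–Shurman, GTM 228, proof of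
Thm. 5.9.2, (5.24)–(5.26); in the tree
`Literature.NumberTheory.Automorphic.LSeries_hasProd_of_recurrence`, from Mathlib's
`EulerProduct.eulerProduct_hasProd`).  All inputs are theorems of the tree:

1. the Hecke relations of a newform on `Γ₁(N)` (Diamond–Shurman Prop. 5.8.5 (3), (2)):
   `a_{mn} = a_m a_n` for `(m, n) = 1` and `a_{p^{r+2}} = a_p a_{p^{r+1}} - ε(p) p^{k-1} a_{p^r}`,
   proved in Part D of `LanglandsTunnellLSeriesProofs`
   (`IsNewform1.cuspCoeff_mul_of_coprime_holds`, `IsNewform1.cuspCoeff_prime_pow_add_two_holds`;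
   in weight one `p^{k-1} = 1`, `IsNewform1.cuspCoeff_prime_pow_add_two.weight_one`);
2. **absolute convergence of `Σ aₙ n^{-s}` for `re s > 1`.**  Deligne–Serre obtain the region
   from Thm. 9.1 (`|aₙ| ≤ d(n)`), whose proof uses Thm. 4.1 and Thm. 4.6, i.e. the whole paper
   (in the tree: the conditional reduction
   `Literature.NumberTheory.Automorphic.ModularForms.norm_cuspCoeff_le_card_divisors_weight_one_of`
   from the named fact `DeligneSerre1974.thm41_exists`).  The region itself is classical and
   elementary in every weight: Rankin's mean-square bound `Σ_{n ≤ X} |aₙ|² = O(X^k)` (Parseval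
   on a horizontal line and `|f(z)| ≤ C y^{-k/2}`) gives absolute convergence of `Σ aₙ n^{-s}`
   for `re s > (k + 1)/2` (Rankin 1977, Thm. 4.5.2 (iv)), which is `re s > 1` for `k = 1`.  This
   is the tree's theorem
   `Literature.NumberTheory.EllipticCurves.ModularForms.LSeriesSummable_cuspCoeff_of_lt_re`
   (`CuspFormLFunctionProofs`, from Mathlib `CuspFormClass.exists_bound` and
   `hasSum_sq_fourierCoeffOn`), specialised here as `LSeriesSummable_cuspCoeff_weight_one`
   (`Γ₁(N)` has cusp width `1` at `∞`, Mathlib `CongruenceSubgroup.strictWidthInfty_Gamma1`).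

So the discharge uses neither Thm. 4.1 nor Thm. 9.1 of Deligne–Serre; what is *not* here is
Thm. 9.1 itself (`norm_cuspCoeff_le_card_divisors_weight_one` stays a named fact, reduced to
Thm. 4.1 in `LanglandsTunnellLSeriesProofs`).

## References

* P. Deligne, J.-P. Serre, *Formes modulaires de poids 1*, Ann. Sci. ÉNS (4) 7 (1974),
  507–530, doi:10.24033/asens.1277 — §1.7 (1.7.1)–(1.7.2), p. 509; §9 Thm. 9.1, Cor. 9.2,
  p. 527 (`DeligneSerreASENS1974`).
* R. A. Rankin, *Modular forms and functions*, Cambridge Univ. Press, 1977, Thm. 4.5.2 (iv)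
  (`Rankin1977`).
* F. Diamond, J. Shurman, *A first course in modular forms*, GTM 228, Springer 2005,
  Prop. 5.8.5, Thm. 5.9.2 and its proof, (5.24)–(5.26) (`DiamondShurman2005`).
-/

noncomputable section

open scoped MatrixGroups ModularForm

open CongruenceSubgroup Complex

namespace Literature.NumberTheory.Automorphic

open EllipticCurves.ModularForms

namespace ModularForms

/-- **Absolute convergence of `L(f, s) = Σ aₙ n^{-s}` on `re s > 1` for a cusp form of weight
one on `Γ₁(N)`** — the half-plane of Deligne–Serre 1974, Cor. 9.2, obtained from Rankin's
mean-square bound instead of Thm. 9.1: the abscissa of absolute convergence of the `L`-series of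
a weight-`k` cusp form is at most `(k + 1)/2` (Rankin 1977, Thm. 4.5.2 (iv);
`LSeriesSummable_cuspCoeff_of_lt_re`, with `Γ₁(N).strictWidthInfty = 1`), and
`(1 + 1)/2 = 1`. [cite: Rankin1977, Thm. 4.5.2 (iv)] -/
theorem LSeriesSummable_cuspCoeff_weight_one {N : ℕ} [NeZero N] (f : CuspForm (Gamma1 N) 1)
    {s : ℂ} (hs : 1 < s.re) : LSeriesSummable (cuspCoeff f) s :=
  LSeriesSummable_cuspCoeff_of_lt_re (strictWidthInfty_Gamma1 N) f (by norm_num; exact hs)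

/-- **(1.7.2) on `re s > 1` for one weight-one newform from its Hecke relations**
(Deligne–Serre 1974, §1.7; Diamond–Shurman, proof of Thm. 5.9.2, (5.24)–(5.26)).  Let
`f = Σ aₙ qⁿ ∈ S_1(Γ₁(N))` be a newform with nebentypus `ε` whose coefficients are
multiplicative on coprime arguments and satisfy `a_{p^{r+2}} = a_p a_{p^{r+1}} - ε(p) a_{p^r}`
at every prime `p`.  Then for `re s > 1`, `L(f, s) = ∏_p (1 - a_p p^{-s} + ε(p) (p^{-s})²)⁻¹`
(`HasProd` over `Nat.Primes`): `LSeries_hasProd_of_recurrence` with `e_p = ε(p)` and the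
absolute convergence `LSeriesSummable_cuspCoeff_weight_one` (Rankin).  The weight-one,
`re s > 1` sharpening of `hasProd_cuspFormLSeries_of_hecke` (`re s > 3/2`) and the
unconditional form of `hasProd_cuspFormLSeries_of_norm_le` (no bound `|aₙ| ≤ d(n)` needed).
[cite: DeligneSerreASENS1974, §1.7 (1.7.2)] -/
theorem hasProd_cuspFormLSeries_weight_one_of_hecke {N : ℕ} [NeZero N]
    {f : CuspForm (Gamma1 N) 1} (hf : IsNewform1 f)
    (hmulc : ∀ {m n : ℕ}, m.Coprime n → cuspCoeff f (m * n) = cuspCoeff f m * cuspCoeff f n)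
    (hrec : ∀ {p : ℕ}, p.Prime → ∀ r : ℕ, cuspCoeff f (p ^ (r + 2)) =
      cuspCoeff f p * cuspCoeff f (p ^ (r + 1)) - nebentypus f (p : ZMod N) * cuspCoeff f (p ^ r))
    {s : ℂ} (hs : 1 < s.re) :
    HasProd (fun p : Nat.Primes ↦
      (1 - cuspCoeff f p * (p : ℂ) ^ (-s) + nebentypus f ((p : ℕ) : ZMod N) * ((p : ℂ) ^ (-s)) ^ 2)⁻¹)
      (cuspFormLSeries f s) :=
  LSeries_hasProd_of_recurrence (a := cuspCoeff f) (e := fun p ↦ nebentypus f (p : ZMod N))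
    hf.2.2.2 hmulc hrec (LSeriesSummable_cuspCoeff_weight_one f hs)

end ModularForms

/-- **Discharge of `IsNewform1.hasProd_cuspFormLSeries_weight_one`** (Deligne–Serre 1974,
§1.7, (1.7.2), p. 509, in weight one on the half-plane `re s > 1` of §9, Cor. 9.2): for a
newform `f = Σ aₙ qⁿ ∈ S_1(Γ₁(N))` with nebentypus `ε` and `re s > 1`,
`L(f, s) = Σ aₙ n^{-s} = ∏_{p ∣ N} (1 - a_p p^{-s})⁻¹ ∏_{p ∤ N} (1 - a_p p^{-s} + ε(p) p^{-2s})⁻¹`,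
the product over the primes converging (`HasProd` over `Nat.Primes`; one formula, `ε(p) = 0`
for `p ∣ N`).  "Il en résulte" from `a_1 = 1` and the Hecke relations
(`IsNewform1.cuspCoeff_mul_of_coprime_holds`, `IsNewform1.cuspCoeff_prime_pow_add_two_holds`,
Diamond–Shurman Prop. 5.8.5 (3), (2), proved in `LanglandsTunnellLSeriesProofs`) through
`ModularForms.hasProd_cuspFormLSeries_weight_one_of_hecke`; the region `re s > 1`, which
loc. cit. takes from Thm. 9.1, is supplied by Rankin's bound
(`ModularForms.LSeriesSummable_cuspCoeff_weight_one`), so neither Thm. 4.1 nor Thm. 9.1 is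
used. [cite: DeligneSerreASENS1974, §1.7 (1.7.2) and §9 Cor. 9.2] -/
theorem _root_.Literature.NumberTheory.EllipticCurves.ModularForms.IsNewform1.hasProd_cuspFormLSeries_weight_one_holds :
    IsNewform1.hasProd_cuspFormLSeries_weight_one := by
  intro N _ f hf s hs
  exact ModularForms.hasProd_cuspFormLSeries_weight_one_of_hecke hf
    (IsNewform1.cuspCoeff_mul_of_coprime_holds hf)
    (IsNewform1.cuspCoeff_prime_pow_add_two_holds.weight_one hf) hs

/-- **`L(s, ρ) = L(s, f)` on `re s > 1` from Thm. 4.6 (b) at `p ∣ N` alone, all-pairs form**: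
with the Euler product (1.7.2) on `re s > 1` now a theorem
(`IsNewform1.hasProd_cuspFormLSeries_weight_one_holds`), the two-input reduction
`artinLFunction_eq_cuspFormLSeries_of_deligneSerre` needs only the local statement of
Deligne–Serre 1974, Thm. 4.6 (b) at the primes dividing the level
(`deligneSerre_eulerPolynomial_eq_of_dvd_level`).  Companion of
`artinLFunction_eq_cuspFormLSeries_of_hecke'` (per-place form of the same input).
[cite: DeligneSerreASENS1974, Thm. 4.6 (b), proof step (iii)] -/
theorem artinLFunction_eq_cuspFormLSeries_of_deligneSerre' {N : ℕ} [NeZero N]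
    {f : CuspForm (Gamma1 N) 1} {ρ : GaloisRepresentations.FramedArtinRep ℚ 2}
    (hloc : deligneSerre_eulerPolynomial_eq_of_dvd_level) :
    artinLFunction_eq_cuspFormLSeries (f := f) (ρ := ρ) :=
  artinLFunction_eq_cuspFormLSeries_of_deligneSerre
    IsNewform1.hasProd_cuspFormLSeries_weight_one_holds hloc

end Literature.NumberTheory.Automorphic

end
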